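import Literature.MathematicalPhysics.QuantumFieldTheory.Balaban1983to89.B1Eq323DisplayedCumulantBoundModels

/-!
# `Balaban1983to89.B2Eq230CondShiftUniform` — T. Bałaban, *(Higgs)₂,₃ quantum fields in a finite volume. II. An upper bound*,
Commun. Math. Phys. **86** (1982) 555–594 [Balaban1982Higgs2] p. 563: *"Because the fields A′, φ′ are small on ∂Λ₅ …, the second terms in
(2.29), (2.30) can be estimated by O(1)p(ε)"* — **WITH AN `O(1)` UNIFORM IN THE LATTICE SPACING `ε ≤ 1`** on the two level-`0` classes where
the tree has Prop. 2.3 (2.34) with scale-uniform constants: zero background on a union of blocks `Ω ⊇ Λ₅`, and an `r`-regular background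
`B^{(1)}` on the whole torus.  This closes HONEST SCOPE (b) of the typer's `B2Eq230CondShiftBound` (*"the constants … carry the lattice spacing
(`ε⁻²` inside `c₀(δ)`), i.e. they are the printed O(1) only on the unit lattice"*) on these classes; theorems only, no definition, no
`Prop`-valued fact.

statement-level skeleton of published theorems with citation tags; proofs where landed; nothing here is a claim about the Yang–Mills mass gap

PDFs held: `paper:balaban1982-cmp86-higgs23-ii` (journal page = PDF page + 554), p. 563 [PDF 9] — quotation as checked on the render by the
typer g7/g8 and r14 g8 in `B2Eq230CondShiftBound`; `paper:balaban1982-cmp85-higgs23-i` (journal page = PDF page + 602), p. 611 [PDF 9].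

CITATION HEADER (lean-in-tree rule).  lit-balaban typed skeleton (HOME `run/shared/lean/pub/lit-balaban/`), unit `lit-balaban-typer` gen 34
(`literature-prover-lit-balaban-typer-g34-0`); a new LEAF next to the typer's own `B2Eq230CondShiftBound` (no tree file re-staled).  SKELETON row
**B2.Eq2.42** ((2.20)–(2.42), fold owner r02, second reader r14), members (2.29)/(2.30) p. 563 — CELLS ONLY, no head change.  USED BY NAME,
NOTHING RESTATED OR EDITED: the typer's `B2Eq230CondShift.{condShiftField, bdrySites, norm_condShiftField_zero_le}` (the (2.30) mechanism
`‖second term‖ ≦ ε⁻²·(2d·Σ_{x′}c(x,x′))·p`), `B2Eq230CondShiftBound.{norm_kernel_le_of_abs_mat_le, kernel_condCov232_apply_of_not_mem_left/right,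
sum_exp_neg_tdist_le}`, r14 g9's `B1Ineq234ZeroFieldRegionUniform.ineq234_zeroField_region_levelZero_uniform` ((2.34) at level `0`, zero field,
printed regions, constants uniform in `ε ≦ 1` — it carries the covariance's natural factor `ε²`), the typer g34's
`B1Eq323DisplayedCumulantBoundModels.ineq234_regular_torus_levelZero_uniform` ((2.34) at level `0`, regular background on `T_ε`, uniform
constants), pv09's `B4Sect5Torus.{cSt, dSt}` and `B4Sect5Proof.latticeConst` (`K_d`).

THE SOURCE TEXT, p. 563 [PDF 9], verbatim: *"Because the fields A′, φ′ are small on ∂Λ₅ = {x ∈ Λ₅ᶜ : x = b₊ for some b ∈ st(Λ₅)}, the second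
terms in (2.29), (2.30) can be estimated by O(1)p(ε)"*.  I p. 611 [PDF 9] (2.34): *"|C^{(k)}_Λ(Ω, A; x, x′)| ≦ c₀exp(−δ₀|x − x′|), x, x′ ∈ Λ"*
with constants *"independent of A, k, Ω and Λ"*.

DICTIONARY.  As in `B2Eq230CondShiftBound`: `C^{(0)}_{Λ₅}(B^{(1)}; x, x′)` ↦ `HiggsCovariance.kernel (condCov232 C Ω B m² a 0 Λ₅) x x′`
(UNWEIGHTED coordinate kernel on `T_ε`, whence the factor `ε⁻²` of the mechanism); the uniform (2.34) instances bound the ENTRIES by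
`ε²·c₁·e^{−δ₁|x−x′|}` — the two powers of `ε` cancel and the print's `O(1)` becomes the explicit, `ε`-free number `2d·N·c₁·K_d(δ₁)` with
`(c₁, δ₁)` functions of `(d, N, L, a, m², δ)` only; `p(ε)` ↦ any bound `p` of `‖φ′(y)‖` on `∂Λ₅ = bdrySites Ω Λ₅`; `Λ₅ = B(Λ′)` ↦ `blockSet Λ′`.

WHAT THIS FILE PROVES (kernel-checked, zero `sorry`, standard axioms; theorems only).
* §1 ZERO BACKGROUND, `Ω` a union of blocks, `Λ₅ = B(Λ′) ⊆ Ω` (`m² > 0`, `a > 0`, `L > 1`, `0 < K`, `ε ≦ 1`, every `δ > 0`):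
  `norm_kernel_condCov232_zeroField_uniform_le` (`‖C^{(0)}_Λ(Ω,0;x,x′)v‖ ≦ N·ε²·c₁·e^{−δ₁|x−x′|}·‖v‖` for every `Λ ⊆ Ω`),
  **`norm_condShiftField_zero_le_zeroField_uniform`** (`‖(second term of (2.30))(x)‖ ≦ (2d·N·c₁·K_d(δ₁))·p`, NO `ε` — print's `O(1)p(ε)`),
  `(c₁, δ₁) = (cSt, dSt)(N·K_d; min{a,8}/L², aL^{−2}e^{δ(L−1)} + (4d+m²)e^{δ}, δ)`; the vector species (2.29) is the member `N = d`, `A = 0`.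
* §2 `r`-REGULAR BACKGROUND `B` ON THE WHOLE TORUS (`Ω = T_ε`; `|B(⟨z+e_ν,μ⟩) − B(⟨z,μ⟩)| ≦ r`, `L²d(2dLε|e|r)² ≦ 1`), every `Λ₅ = B(Λ′)`:
  `norm_kernel_condCov232_regular_uniform_le`, **`norm_condShiftField_zero_le_regular_uniform`** (same shape with
  `(c₁, δ₁) = (cSt, dSt)(N·K_d; 3min{a,4}/(4L²), aL^{−2}e^{δ(L−1)} + (4d+m²)e^{δ}, δ)`).
HONEST SCOPE.  (i) Level `0` only (the first step, as `B2Eq230CondShiftBound`); the classes are those of the two uniform (2.34) instances — a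
general (large) background is not covered, as in print (*"A regular"*).  (ii) `p` is any common bound of `‖φ′‖` on `∂Λ₅`; that the
characteristic functions make it `p(ε)` is (2.7)/(2.55)'s content.  (iii) Constants explicit but crude (the Sect.-5 engine's), factor `N` from the
orthonormal site frame; the zero-field class needs `Ω` to be a union of `1`-blocks containing `Λ₅` (r14 g9's printed-regions hypothesis), the regular
class `Ω = T_ε`.  (iv) Value = the printed *"O(1)"* made `ε`-uniform on the concrete carrier; NOT summit progress; NOT Clay.
-/

open scoped BigOperators

namespace Literature.MathematicalPhysics.QuantumFieldTheory.Balaban1983to89.B2Eq230CondShiftUniform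

open HiggsLattice (ChargeData ScalarField)
open HiggsCovariance (E kernel)
open HiggsCondCov232 (condCov232)
open B1Eq230FluctCov (mat Ix)
open B2Eq230CondShift (condShiftField bdrySites norm_condShiftField_zero_le)
open B2Eq230CondShiftBound (norm_kernel_le_of_abs_mat_le kernel_condCov232_apply_of_not_mem_left
  kernel_condCov232_apply_of_not_mem_right sum_exp_neg_tdist_le)
open B4Sect5Torus (cSt dSt cSt_pos dSt_pos)
open B1Ineq234Concrete (profile profile_nonneg')
open B1Ineq234ZeroFieldRegionUniform (ineq234_zeroField_region_levelZero_uniform)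
open B1Eq323DisplayedCumulantBoundModels (ineq234_regular_torus_levelZero_uniform)

noncomputable section

variable {P : HiggsLattice.Params} {N : ℕ}

/-! ## §1 Zero background on a union of blocks `Ω ⊇ Λ₅`: the `O(1)` of p. 563 uniform in `ε ≤ 1` -/

section ZeroField

variable (C : ChargeData N) (Ω : Finset (HiggsLattice.Site P 0)) {a msq : ℝ}

/-- **(2.34) AT LEVEL `0`, ZERO BACKGROUND, IN OPERATOR NORM WITH `ε`-UNIFORM CONSTANTS**: for `m² > 0`, `a > 0`, `L > 1`, `0 < K`, `ε ≦ 1`,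
`δ > 0`, `Ω` a union of blocks and `Λ ⊆ Ω`: `‖C^{(0)}_Λ(Ω, 0; x, x′)v‖ ≦ N·(ε²·c₁·e^{−δ₁|x−x′|})·‖v‖` for all `x, x′, v` (entries on `Λ × Λ` by
r14 g9's `ineq234_zeroField_region_levelZero_uniform` through `norm_kernel_le_of_abs_mat_le`, zero off `Λ × Λ`).
[cite: Balaban1982Higgs1, Prop. 2.3 (2.34) p.611] -/
theorem norm_kernel_condCov232_zeroField_uniform_le (ha : 0 < a) (hL : 1 < P.L) (hmsq : 0 < msq) (hK : 0 < P.K)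
    (hs : P.mesh 0 ≤ 1) {δ : ℝ} (hδ : 0 < δ)
    (hU : ∀ x x' : HiggsLattice.Site P 0, HiggsLattice.blockOf x = HiggsLattice.blockOf x' → (x ∈ Ω ↔ x' ∈ Ω))
    {Λ : Finset (HiggsLattice.Site P 0)} (hΛ : Λ ⊆ Ω) (x x' : HiggsLattice.Site P 0) (v : E N) :
    ‖kernel (condCov232 C Ω (0 : HiggsLattice.VecField P 0) msq a 0 Λ) x x' v‖ ≤
      (N : ℝ) * (P.mesh 0 ^ 2 *
          cSt (profile P N) (min a 8 / (P.L : ℝ) ^ 2)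
            (a * ((P.L : ℝ) ^ 2)⁻¹ * Real.exp (δ * ((P.L : ℝ) - 1)) + (4 * P.d + msq) * Real.exp δ) δ *
          Real.exp (-(dSt (profile P N) (min a 8 / (P.L : ℝ) ^ 2)
            (a * ((P.L : ℝ) ^ 2)⁻¹ * Real.exp (δ * ((P.L : ℝ) - 1)) + (4 * P.d + msq) * Real.exp δ) δ *
            (HiggsLattice.Site.tdist x x' : ℝ)))) * ‖v‖ := by
  have hL0 : (0 : ℝ) < (P.L : ℝ) := by exact_mod_cast (lt_trans Nat.zero_lt_one hL)
  have hγ : 0 < min a 8 / (P.L : ℝ) ^ 2 := div_pos (lt_min ha (by norm_num)) (pow_pos hL0 2)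
  have hm0 : 0 ≤ P.mesh 0 ^ 2 *
      cSt (profile P N) (min a 8 / (P.L : ℝ) ^ 2)
        (a * ((P.L : ℝ) ^ 2)⁻¹ * Real.exp (δ * ((P.L : ℝ) - 1)) + (4 * P.d + msq) * Real.exp δ) δ *
      Real.exp (-(dSt (profile P N) (min a 8 / (P.L : ℝ) ^ 2)
        (a * ((P.L : ℝ) ^ 2)⁻¹ * Real.exp (δ * ((P.L : ℝ) - 1)) + (4 * P.d + msq) * Real.exp δ) δ *
        (HiggsLattice.Site.tdist x x' : ℝ))) :=
    mul_nonneg (mul_nonneg (sq_nonneg _) (cSt_pos _ _ _ hγ).le) (Real.exp_pos _).le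
  by_cases hx : x ∈ Λ
  · by_cases hx' : x' ∈ Λ
    · exact norm_kernel_le_of_abs_mat_le _ x x' hm0
        (fun i j => ineq234_zeroField_region_levelZero_uniform C Ω ha hL hmsq hK hs hδ hU hΛ (p := (x, i)) (q := (x', j)) hx hx') v
    · rw [kernel_condCov232_apply_of_not_mem_right C Ω 0 msq a Λ x hx', norm_zero]
      exact mul_nonneg (mul_nonneg (Nat.cast_nonneg N) hm0) (norm_nonneg v)
  · rw [kernel_condCov232_apply_of_not_mem_left C Ω 0 msq a Λ hx, norm_zero]
    exact mul_nonneg (mul_nonneg (Nat.cast_nonneg N) hm0) (norm_nonneg v)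

/-- **p. 563 *"the second terms in (2.29), (2.30) can be estimated by O(1)p(ε)"* WITH `O(1)` UNIFORM IN `ε ≦ 1` — ZERO BACKGROUND**: for
`m² > 0`, `a > 0`, `L > 1`, `0 < K`, `ε ≦ 1`, `δ > 0`, `Ω` a union of blocks with `Λ₅ = B(Λ′) ⊆ Ω`, every `φ′` with `‖φ′(y)‖ ≦ p` on `∂Λ₅` and
every site `x`: `‖(second term of (2.30))(x)‖ ≦ (2d·N·c₁·K_d(δ₁))·p` — NO power of `ε` left (the mechanism's `ε⁻²` against the covariance's
`ε²`); `(c₁, δ₁) = (cSt, dSt)(N·K_d; min{a,8}/L², aL^{−2}e^{δ(L−1)} + (4d+m²)e^{δ}, δ)` depend on `(d, N, L, a, m², δ)` only. The vector species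
(2.29) is the member `N = d`, background `0`. [cite: Balaban1982Higgs2, (2.30) p.563] -/
theorem norm_condShiftField_zero_le_zeroField_uniform (ha : 0 < a) (hL : 1 < P.L) (hmsq : 0 < msq) (hK : 0 < P.K)
    (hs : P.mesh 0 ≤ 1) {δ : ℝ} (hδ : 0 < δ)
    (hU : ∀ x x' : HiggsLattice.Site P 0, HiggsLattice.blockOf x = HiggsLattice.blockOf x' → (x ∈ Ω ↔ x' ∈ Ω))
    (Λ' : Finset (HiggsLattice.Site P 1)) (hΛ : HiggsLattice.blockSet Λ' ⊆ Ω) {φ : ScalarField P 0 N} {p : ℝ} (hp : 0 ≤ p)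
    (hφ : ∀ y ∈ bdrySites Ω (HiggsLattice.blockSet Λ'), ‖φ y‖ ≤ p) (x : HiggsLattice.Site P 0) :
    ‖condShiftField C Ω (0 : HiggsLattice.VecField P 0) msq a 0 (HiggsLattice.blockSet Λ') φ x‖
      ≤ (2 * (P.d : ℝ) * ((N : ℝ) *
            cSt (profile P N) (min a 8 / (P.L : ℝ) ^ 2)
              (a * ((P.L : ℝ) ^ 2)⁻¹ * Real.exp (δ * ((P.L : ℝ) - 1)) + (4 * P.d + msq) * Real.exp δ) δ *
            B4Sect5Proof.latticeConst P.d (dSt (profile P N) (min a 8 / (P.L : ℝ) ^ 2)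
              (a * ((P.L : ℝ) ^ 2)⁻¹ * Real.exp (δ * ((P.L : ℝ) - 1)) + (4 * P.d + msq) * Real.exp δ) δ))) * p := by
  set c₁ := cSt (profile P N) (min a 8 / (P.L : ℝ) ^ 2)
    (a * ((P.L : ℝ) ^ 2)⁻¹ * Real.exp (δ * ((P.L : ℝ) - 1)) + (4 * P.d + msq) * Real.exp δ) δ with hc₁
  set δ₁ := dSt (profile P N) (min a 8 / (P.L : ℝ) ^ 2)
    (a * ((P.L : ℝ) ^ 2)⁻¹ * Real.exp (δ * ((P.L : ℝ) - 1)) + (4 * P.d + msq) * Real.exp δ) δ with hδ₁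
  have hL0 : (0 : ℝ) < (P.L : ℝ) := by exact_mod_cast (lt_trans Nat.zero_lt_one hL)
  have hγ : 0 < min a 8 / (P.L : ℝ) ^ 2 := div_pos (lt_min ha (by norm_num)) (pow_pos hL0 2)
  have hc0 : 0 < c₁ := cSt_pos _ _ _ hγ
  have hκ : 0 ≤ a * ((P.L : ℝ) ^ 2)⁻¹ * Real.exp (δ * ((P.L : ℝ) - 1)) + (4 * P.d + msq) * Real.exp δ := by positivity
  have hr0 : 0 < δ₁ := dSt_pos profile_nonneg' hγ hκ hδ
  have hm : 0 < P.mesh 0 := P.mesh_pos 0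
  -- the mechanism with the entrywise-uniform kernel bound
  have h := norm_condShiftField_zero_le C Ω (0 : HiggsLattice.VecField P 0) msq a Λ'
    (c := fun x x' => (N : ℝ) * (P.mesh 0 ^ 2 * c₁ * Real.exp (-(δ₁ * (HiggsLattice.Site.tdist x x' : ℝ)))))
    (fun x x' v => norm_kernel_condCov232_zeroField_uniform_le C Ω ha hL hmsq hK hs hδ hU hΛ x x' v)
    (fun _ _ => mul_nonneg (Nat.cast_nonneg N) (mul_nonneg (mul_nonneg (sq_nonneg _) hc0.le) (Real.exp_pos _).le)) hp hφ x
  -- the torus sum and the cancellation `ε⁻²·ε² = 1`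
  have hsum : ∑ x' : HiggsLattice.Site P 0, (N : ℝ) * (P.mesh 0 ^ 2 * c₁ * Real.exp (-(δ₁ * (HiggsLattice.Site.tdist x x' : ℝ))))
      ≤ (N : ℝ) * (P.mesh 0 ^ 2 * c₁ * B4Sect5Proof.latticeConst P.d δ₁) := by
    rw [← Finset.mul_sum, ← Finset.mul_sum]
    exact mul_le_mul_of_nonneg_left (mul_le_mul_of_nonneg_left (sum_exp_neg_tdist_le hr0 x) (mul_nonneg (sq_nonneg _) hc0.le))
      (Nat.cast_nonneg N)
  have hε : 0 ≤ (P.mesh 0)⁻¹ ^ 2 := pow_nonneg (inv_nonneg.mpr hm.le) 2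
  have hd : 0 ≤ 2 * (P.d : ℝ) := by positivity
  have hcancel : (P.mesh 0)⁻¹ ^ 2 * P.mesh 0 ^ 2 = 1 := by
    rw [inv_pow, inv_mul_cancel₀ (pow_ne_zero 2 hm.ne')]
  calc _ ≤ _ := h
    _ ≤ (P.mesh 0)⁻¹ ^ 2 * (2 * (P.d : ℝ) * ((N : ℝ) * (P.mesh 0 ^ 2 * c₁ * B4Sect5Proof.latticeConst P.d δ₁))) * p :=
        mul_le_mul_of_nonneg_right (mul_le_mul_of_nonneg_left (mul_le_mul_of_nonneg_left hsum hd) hε) hp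
    _ = ((P.mesh 0)⁻¹ ^ 2 * P.mesh 0 ^ 2) * ((2 * (P.d : ℝ) * ((N : ℝ) * c₁ * B4Sect5Proof.latticeConst P.d δ₁)) * p) := by ring
    _ = _ := by rw [hcancel, one_mul]

end ZeroField

/-! ## §2 A regular background on the whole torus: the `O(1)` of p. 563 uniform in `ε ≤ 1` -/

section Regular

variable (C : ChargeData N) {a msq : ℝ}

/-- **(2.34) AT LEVEL `0`, `r`-REGULAR BACKGROUND ON `T_ε`, IN OPERATOR NORM WITH `ε`-UNIFORM CONSTANTS**: for `a, m² > 0`, `0 < K`, `ε ≦ 1`, a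
background `B` with `|B(⟨z+e_ν,μ⟩) − B(⟨z,μ⟩)| ≦ r`, `L²d(2dLε|e|r)² ≦ 1`, `δ > 0`, every `Λ`:
`‖C^{(0)}_Λ(T_ε, B; x, x′)v‖ ≦ N·(ε²·c₁·e^{−δ₁|x−x′|})·‖v‖`, `(c₁, δ₁) = (cSt, dSt)(N·K_d; 3min{a,4}/(4L²), aL^{−2}e^{δ(L−1)} + (4d+m²)e^{δ}, δ)`
(the typer g34's `ineq234_regular_torus_levelZero_uniform` through `norm_kernel_le_of_abs_mat_le`).
[cite: Balaban1982Higgs1, Prop. 2.3 (2.34) p.611; Prop. 2.1 (2.23) p.610] -/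
theorem norm_kernel_condCov232_regular_uniform_le (ha : 0 < a) (hmsq : 0 < msq) (hK : 0 < P.K) (hs : P.mesh 0 ≤ 1)
    (B : HiggsLattice.VecField P 0) {r : ℝ} (hr : 0 ≤ r)
    (hreg : ∀ (z : HiggsLattice.Site P 0) (μ' ν : Fin P.d), |B ⟨z.shift ν, μ'⟩ - B ⟨z, μ'⟩| ≤ r)
    (hθ : (P.L : ℝ) ^ 2 * P.d * (2 * P.d * P.L * (P.mesh 0 * |C.e|) * r) ^ 2 ≤ 1) {δ : ℝ} (hδ : 0 < δ)
    (Λ : Finset (HiggsLattice.Site P 0)) (x x' : HiggsLattice.Site P 0) (v : E N) :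
    ‖kernel (condCov232 C Finset.univ B msq a 0 Λ) x x' v‖ ≤
      (N : ℝ) * (P.mesh 0 ^ 2 *
          cSt (profile P N) (3 * (min a 4 / (P.L : ℝ) ^ 2) / 4)
            (a * ((P.L : ℝ) ^ 2)⁻¹ * Real.exp (δ * ((P.L : ℝ) - 1)) + (4 * P.d + msq) * Real.exp δ) δ *
          Real.exp (-(dSt (profile P N) (3 * (min a 4 / (P.L : ℝ) ^ 2) / 4)
            (a * ((P.L : ℝ) ^ 2)⁻¹ * Real.exp (δ * ((P.L : ℝ) - 1)) + (4 * P.d + msq) * Real.exp δ) δ *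
            (HiggsLattice.Site.tdist x x' : ℝ)))) * ‖v‖ := by
  have hL0 : (0 : ℝ) < (P.L : ℝ) := by exact_mod_cast (lt_of_lt_of_le Nat.zero_lt_one P.hL)
  have hγ : 0 < 3 * (min a 4 / (P.L : ℝ) ^ 2) / 4 := by
    have : 0 < min a 4 := lt_min ha (by norm_num)
    positivity
  have hm0 : 0 ≤ P.mesh 0 ^ 2 *
      cSt (profile P N) (3 * (min a 4 / (P.L : ℝ) ^ 2) / 4)
        (a * ((P.L : ℝ) ^ 2)⁻¹ * Real.exp (δ * ((P.L : ℝ) - 1)) + (4 * P.d + msq) * Real.exp δ) δ *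
      Real.exp (-(dSt (profile P N) (3 * (min a 4 / (P.L : ℝ) ^ 2) / 4)
        (a * ((P.L : ℝ) ^ 2)⁻¹ * Real.exp (δ * ((P.L : ℝ) - 1)) + (4 * P.d + msq) * Real.exp δ) δ *
        (HiggsLattice.Site.tdist x x' : ℝ))) :=
    mul_nonneg (mul_nonneg (sq_nonneg _) (cSt_pos _ _ _ hγ).le) (Real.exp_pos _).le
  by_cases hx : x ∈ Λ
  · by_cases hx' : x' ∈ Λ
    · exact norm_kernel_le_of_abs_mat_le _ x x' hm0
        (fun i j => ineq234_regular_torus_levelZero_uniform C ha hmsq hK hs B hr hreg hθ hδ Λ (p := (x, i)) (q := (x', j)) hx hx') v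
    · rw [kernel_condCov232_apply_of_not_mem_right C Finset.univ B msq a Λ x hx', norm_zero]
      exact mul_nonneg (mul_nonneg (Nat.cast_nonneg N) hm0) (norm_nonneg v)
  · rw [kernel_condCov232_apply_of_not_mem_left C Finset.univ B msq a Λ hx, norm_zero]
    exact mul_nonneg (mul_nonneg (Nat.cast_nonneg N) hm0) (norm_nonneg v)

/-- **p. 563 *"… can be estimated by O(1)p(ε)"* WITH `O(1)` UNIFORM IN `ε ≦ 1` — `r`-REGULAR BACKGROUND `B^{(1)}` ON THE WHOLE TORUS** (the
setting of (2.30) at the first step with `Ω = T_ε`): for `a, m² > 0`, `0 < K`, `ε ≦ 1`, `|B(⟨z+e_ν,μ⟩) − B(⟨z,μ⟩)| ≦ r`, `L²d(2dLε|e|r)² ≦ 1`,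
`δ > 0`, every `Λ₅ = B(Λ′)`, every `φ′` with `‖φ′(y)‖ ≦ p` on `∂Λ₅`, every `x`: `‖(second term of (2.30))(x)‖ ≦ (2d·N·c₁·K_d(δ₁))·p` with the
`ε`-free `(c₁, δ₁) = (cSt, dSt)(N·K_d; 3min{a,4}/(4L²), aL^{−2}e^{δ(L−1)} + (4d+m²)e^{δ}, δ)`. [cite: Balaban1982Higgs2, (2.30) p.563] -/
theorem norm_condShiftField_zero_le_regular_uniform (ha : 0 < a) (hmsq : 0 < msq) (hK : 0 < P.K) (hs : P.mesh 0 ≤ 1)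
    (B : HiggsLattice.VecField P 0) {r : ℝ} (hr : 0 ≤ r)
    (hreg : ∀ (z : HiggsLattice.Site P 0) (μ' ν : Fin P.d), |B ⟨z.shift ν, μ'⟩ - B ⟨z, μ'⟩| ≤ r)
    (hθ : (P.L : ℝ) ^ 2 * P.d * (2 * P.d * P.L * (P.mesh 0 * |C.e|) * r) ^ 2 ≤ 1) {δ : ℝ} (hδ : 0 < δ)
    (Λ' : Finset (HiggsLattice.Site P 1)) {φ : ScalarField P 0 N} {p : ℝ} (hp : 0 ≤ p)
    (hφ : ∀ y ∈ bdrySites Finset.univ (HiggsLattice.blockSet Λ'), ‖φ y‖ ≤ p) (x : HiggsLattice.Site P 0) :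
    ‖condShiftField C Finset.univ B msq a 0 (HiggsLattice.blockSet Λ') φ x‖
      ≤ (2 * (P.d : ℝ) * ((N : ℝ) *
            cSt (profile P N) (3 * (min a 4 / (P.L : ℝ) ^ 2) / 4)
              (a * ((P.L : ℝ) ^ 2)⁻¹ * Real.exp (δ * ((P.L : ℝ) - 1)) + (4 * P.d + msq) * Real.exp δ) δ *
            B4Sect5Proof.latticeConst P.d (dSt (profile P N) (3 * (min a 4 / (P.L : ℝ) ^ 2) / 4)
              (a * ((P.L : ℝ) ^ 2)⁻¹ * Real.exp (δ * ((P.L : ℝ) - 1)) + (4 * P.d + msq) * Real.exp δ) δ))) * p := by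
  set c₁ := cSt (profile P N) (3 * (min a 4 / (P.L : ℝ) ^ 2) / 4)
    (a * ((P.L : ℝ) ^ 2)⁻¹ * Real.exp (δ * ((P.L : ℝ) - 1)) + (4 * P.d + msq) * Real.exp δ) δ with hc₁
  set δ₁ := dSt (profile P N) (3 * (min a 4 / (P.L : ℝ) ^ 2) / 4)
    (a * ((P.L : ℝ) ^ 2)⁻¹ * Real.exp (δ * ((P.L : ℝ) - 1)) + (4 * P.d + msq) * Real.exp δ) δ with hδ₁
  have hL0 : (0 : ℝ) < (P.L : ℝ) := by exact_mod_cast (lt_of_lt_of_le Nat.zero_lt_one P.hL)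
  have hγ : 0 < 3 * (min a 4 / (P.L : ℝ) ^ 2) / 4 := by
    have : 0 < min a 4 := lt_min ha (by norm_num)
    positivity
  have hc0 : 0 < c₁ := cSt_pos _ _ _ hγ
  have hκ : 0 ≤ a * ((P.L : ℝ) ^ 2)⁻¹ * Real.exp (δ * ((P.L : ℝ) - 1)) + (4 * P.d + msq) * Real.exp δ := by positivity
  have hr0 : 0 < δ₁ := dSt_pos profile_nonneg' hγ hκ hδ
  have hm : 0 < P.mesh 0 := P.mesh_pos 0
  have h := norm_condShiftField_zero_le C Finset.univ B msq a Λ'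
    (c := fun x x' => (N : ℝ) * (P.mesh 0 ^ 2 * c₁ * Real.exp (-(δ₁ * (HiggsLattice.Site.tdist x x' : ℝ)))))
    (fun x x' v => norm_kernel_condCov232_regular_uniform_le C ha hmsq hK hs B hr hreg hθ hδ _ x x' v)
    (fun _ _ => mul_nonneg (Nat.cast_nonneg N) (mul_nonneg (mul_nonneg (sq_nonneg _) hc0.le) (Real.exp_pos _).le)) hp hφ x
  have hsum : ∑ x' : HiggsLattice.Site P 0, (N : ℝ) * (P.mesh 0 ^ 2 * c₁ * Real.exp (-(δ₁ * (HiggsLattice.Site.tdist x x' : ℝ))))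
      ≤ (N : ℝ) * (P.mesh 0 ^ 2 * c₁ * B4Sect5Proof.latticeConst P.d δ₁) := by
    rw [← Finset.mul_sum, ← Finset.mul_sum]
    exact mul_le_mul_of_nonneg_left (mul_le_mul_of_nonneg_left (sum_exp_neg_tdist_le hr0 x) (mul_nonneg (sq_nonneg _) hc0.le))
      (Nat.cast_nonneg N)
  have hε : 0 ≤ (P.mesh 0)⁻¹ ^ 2 := pow_nonneg (inv_nonneg.mpr hm.le) 2
  have hd : 0 ≤ 2 * (P.d : ℝ) := by positivity
  have hcancel : (P.mesh 0)⁻¹ ^ 2 * P.mesh 0 ^ 2 = 1 := by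
    rw [inv_pow, inv_mul_cancel₀ (pow_ne_zero 2 hm.ne')]
  calc _ ≤ _ := h
    _ ≤ (P.mesh 0)⁻¹ ^ 2 * (2 * (P.d : ℝ) * ((N : ℝ) * (P.mesh 0 ^ 2 * c₁ * B4Sect5Proof.latticeConst P.d δ₁))) * p :=
        mul_le_mul_of_nonneg_right (mul_le_mul_of_nonneg_left (mul_le_mul_of_nonneg_left hsum hd) hε) hp
    _ = ((P.mesh 0)⁻¹ ^ 2 * P.mesh 0 ^ 2) * ((2 * (P.d : ℝ) * ((N : ℝ) * c₁ * B4Sect5Proof.latticeConst P.d δ₁)) * p) := by ring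
    _ = _ := by rw [hcancel, one_mul]

end Regular

end

end Literature.MathematicalPhysics.QuantumFieldTheory.Balaban1983to89.B2Eq230CondShiftUniform
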